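import Summits.Ventures.CertifiedArithmetic.LowPrec.Accumulate

/-!
# The deficit lemma of the regime theory: a rounding step gains at most the modulus of its term

HONEST FRAMING (venture CertifiedArithmetic / cell `pub-lowprec`, seat gemm, gen 4): certified error
envelopes and provably optimal rounding/accumulation schemes for low-precision formats under stated
cost models; every table by two implementations; no hardware or vendor claims.

Paper `gemm.tex` §Regimes, Lemma (deficits)(i), kernel-checked for every format: if the accumulator
holds a value `y` of the format and the term `p` is added under round-to-nearest-even, the *gain*
`δ = fl(y + p) - (y + p)` of the step satisfies `|δ| ≤ |p|` — because `y` itself is a candidate and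
`roundNE` returns a nearest value (`roundNE_nearest`).  Hence the *deficit* `|p| - δ` of every step
is nonnegative, and along a whole sequential accumulation with a representable first term the gain
`ŝₙ - Σ_{i ≤ n} xᵢ` is at most `Σ_{1 ≤ i ≤ n} |xᵢ|` (the first term contributes mass but no gain):
`abs_seqSum_sub_sum_le_sum_abs_tail`.  Consequently the relative error `|ŝₙ - Σ xᵢ| / Σ |xᵢ|` of a
sequential sum whose first term is a nonzero value of the format is `< 1` for every `n`
(`abs_seqSum_sub_sum_lt_sum_abs`; paper Prop. "W(n) → 1"(a)) — the quantity that the certified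
terminal regimes show tends to `1` like `1 - D*/(c* n)`.  These statements need no range hypothesis:
`roundNE` is nearest-value rounding into the finite values (saturating), so they hold verbatim in the
cell's `FIN(n)` model and outside it.
-/

namespace Literature.ComputerArithmetic.FloatingPoint

namespace MiniFloat

open Finset

variable {α : Format}

/-- LEMMA D, one step, two-sided: adding `p` to a representable accumulator value `y` under
round-to-nearest-even moves the result by at most `|p|` away from the exact sum:
`|fl(y + p) - (y + p)| ≤ |p|`. [folklore] -/
theorem abs_gain_step_le (y : MiniFloat α) (p : ℚ) :
    |(roundNE α (y.toRat + p)).toRat - (y.toRat + p)| ≤ |p| := by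
  have h := roundNE_nearest (φ := α) (y.toRat + p) y
  rw [abs_sub_comm]
  calc |y.toRat + p - (roundNE α (y.toRat + p)).toRat| ≤ |y.toRat + p - y.toRat| := h
    _ = |p| := by ring_nf

/-- LEMMA D, one step, as used in the regime theory: the gain `δ = fl(y + p) - (y + p)` is at most
`|p|`, i.e. the deficit `|p| - δ` is nonnegative. [folklore] -/
theorem gain_step_le_abs (y : MiniFloat α) (p : ℚ) :
    (roundNE α (y.toRat + p)).toRat - (y.toRat + p) ≤ |p| :=
  le_trans (le_abs_self _) (abs_gain_step_le y p)

/-- The deficit of a step is nonnegative: `0 ≤ |p| - (fl(y + p) - (y + p))`. [folklore] -/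
theorem deficit_step_nonneg (y : MiniFloat α) (p : ℚ) :
    0 ≤ |p| - ((roundNE α (y.toRat + p)).toRat - (y.toRat + p)) :=
  sub_nonneg.mpr (gain_step_le_abs y p)

/-- LEMMA D along a sequential accumulation with a representable first term: the total gain is
bounded by the mass of the terms AFTER the first one,
`|ŝₙ - Σ_{i ≤ n} xᵢ| ≤ Σ_{1 ≤ i ≤ n} |xᵢ|`. [folklore] -/
theorem abs_seqSum_sub_sum_le_sum_abs_tail (x : ℕ → ℚ) (h0 : ∃ y : MiniFloat α, y.toRat = x 0) :
    ∀ n, |(seqSum α x n).toRat - ∑ i ∈ range (n + 1), x i| ≤ ∑ i ∈ Ico 1 (n + 1), |x i|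
  | 0 => by
      simp only [seqSum, zero_add, range_one, sum_singleton, toRat_roundNE_of_exists h0, sub_self,
        abs_zero]
      exact sum_nonneg fun i _ => abs_nonneg _
  | n + 1 => by
      have ih := abs_seqSum_sub_sum_le_sum_abs_tail x h0 n
      have hstep := abs_gain_step_le (seqSum α x n) (x (n + 1))
      rw [sum_range_succ, Finset.sum_Ico_succ_top (by omega : 1 ≤ n + 1)]
      simp only [seqSum]
      calc |(roundNE α ((seqSum α x n).toRat + x (n + 1))).toRat
              - (∑ i ∈ range (n + 1), x i + x (n + 1))|
            = |((roundNE α ((seqSum α x n).toRat + x (n + 1))).toRat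
                  - ((seqSum α x n).toRat + x (n + 1)))
                + ((seqSum α x n).toRat - ∑ i ∈ range (n + 1), x i)| := by ring_nf
        _ ≤ |(roundNE α ((seqSum α x n).toRat + x (n + 1))).toRat
                  - ((seqSum α x n).toRat + x (n + 1))|
                + |(seqSum α x n).toRat - ∑ i ∈ range (n + 1), x i| := abs_add_le _ _
        _ ≤ |x (n + 1)| + ∑ i ∈ Ico 1 (n + 1), |x i| := add_le_add hstep ih
        _ = ∑ i ∈ Ico 1 (n + 1), |x i| + |x (n + 1)| := add_comm _ _

/-- One-sided form (the signed gain of the regime theory): `ŝₙ - Σ_{i ≤ n} xᵢ ≤ Σ_{1 ≤ i ≤ n} |xᵢ|`.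
[folklore] -/
theorem seqSum_sub_sum_le_sum_abs_tail (x : ℕ → ℚ) (h0 : ∃ y : MiniFloat α, y.toRat = x 0) (n : ℕ) :
    (seqSum α x n).toRat - ∑ i ∈ range (n + 1), x i ≤ ∑ i ∈ Ico 1 (n + 1), |x i| :=
  le_trans (le_abs_self _) (abs_seqSum_sub_sum_le_sum_abs_tail x h0 n)

/-- THE WORST CASE IS ALWAYS BELOW ONE: for a sequential accumulation whose first term is a nonzero
value of the format, `|ŝₙ - Σ_{i ≤ n} xᵢ| < Σ_{i ≤ n} |xᵢ|` for every `n` (paper Prop. "W(n) → 1"(a);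
the certified terminal regimes show the ratio nevertheless tends to `1`). [folklore] -/
theorem abs_seqSum_sub_sum_lt_sum_abs (x : ℕ → ℚ) (h0 : ∃ y : MiniFloat α, y.toRat = x 0)
    (hx : x 0 ≠ 0) (n : ℕ) :
    |(seqSum α x n).toRat - ∑ i ∈ range (n + 1), x i| < ∑ i ∈ range (n + 1), |x i| := by
  have h := abs_seqSum_sub_sum_le_sum_abs_tail x h0 n
  have hsplit : ∑ i ∈ range (n + 1), |x i| = |x 0| + ∑ i ∈ Ico 1 (n + 1), |x i| := by
    rw [Finset.range_eq_Ico, ← Finset.sum_eq_sum_Ico_succ_bot (by omega : 0 < n + 1) (fun i => |x i|)]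
  rw [hsplit]
  have hpos : 0 < |x 0| := abs_pos.mpr hx
  linarith

end MiniFloat

end Literature.ComputerArithmetic.FloatingPoint
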